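/-
Copyright: the b2b-balaban T⁴-continuum CRUX team, row NE7b leaf lineage `t4-ne7b-formalise-leaf-05` (gen 157). Project licence.
-/
import Mathlib.Algebra.BigOperators.Ring.Finset
import Mathlib.Algebra.Order.BigOperators.Ring.Finset
import Mathlib.Data.Fintype.BigOperators
import Mathlib.Analysis.Normed.Field.Basic

/-!
# THE PRODUCT OF ONE-AXIS PARTITIONS OVER `d` AXES: `Φ_S(x) = Π_ν φ_{S_ν}(x_ν)` keeps `Σ_S Φ_S = 1` and `0 ≤ Φ_S ≤ 1`, has at most `Π_ν #alive_ν ≤ μ₁^d` cubes alive,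
# and a change of ONE coordinate moves it by no more than the one-axis family moves — pointwise `|ΔΦ_S| ≤ |Δφ_{S_ν}|` and in `ℓ²(cubes)` WITH NO `2^d` FACTOR:
# `Σ_S (ΔΦ_S)² ≤ Σ_s (Δφ_s)²` — the `d`-axis half of the tent supplier of `…AdmissibleFloorLinearPartition` (row NE7b, node U5c; residual (R2′) family (2), letter (ℓ1);
# kernel lemmas)

Cell `pub-balaban`, sub-cell `t4`, spine estimate NE7b (`T4WeightBudget.RelWeightBound`; the cell's OWN estimate — NOT PRINTED in [Bałaban 1983–89],
NOT PROVED).  Crux-route work under `Spine/NE7b/`; NOTHING of Bałaban's is asserted; no `def`; zero `sorry`; no `T4Continuum/Support` leaf (FREEZE (0)).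
Imports: Mathlib only (`BigOperators.Ring.Finset` for `Finset.sum_prod_piFinset`, `Fintype.piFinset_univ`, `card_piFinset`).

WHY.  `…TentPartitionChain` (TPC, this gen) is the one-axis tent (`Σ_s φ_s = 1`, `0 ≤ φ ≤ 1`, ≤ 2 alive, chain steps `≤ 1∕M` ∕ `≤ 2∕M²` in `ℓ²`); print's `{h_□}` on
the `d`-dimensional lattice is (the normalisation of) the PRODUCT over the axes.  THIS FILE proves the product bookkeeping ABSTRACTLY — for any one-axis family
`φ : ι → X → ℝ` with `Σ_s φ_s(y) = 1` and `0 ≤ φ_s(y) ≤ 1` — so that AFLP's four partition letters on the torus follow from TPC axis by axis: the sum (by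
`Finset.sum_prod_piFinset`), the bounds, the multiplicity `Π_ν #alive_ν` (`card_piFinset`), and the one-coordinate step: `Φ_S(x′) − Φ_S(x) = (Π_{μ≠ν}φ_{S_μ}(x_μ))·
(φ_{S_ν}(y′) − φ_{S_ν}(x_ν))`, whose prefactor lies in `[0, 1]` (pointwise letter) and whose SQUARE is at most itself, so that summing over `S` and factorising the
sum over the product index gives `Π_{μ≠ν}(Σ_sφ_s(x_μ))·Σ_s(Δφ_s)² = Σ_s(Δφ_s)²` — the `ℓ²` step letter passes to `d` axes with constant ONE.

WHAT IS PROVED ([folklore]; axes `ν : Fin d`-like finite type `A`, cubes per axis `ι`, sites per axis `X`; `Φ_S(x) := Π_ν φ (S ν) (x ν)` written out):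
* §1 **`sum_prod_eq_one`** (`Σ_S Π_ν φ_{S_ν}(x_ν) = 1`), `prod_nonneg'` ∕ `prod_le_one'` (`0 ≤ Φ_S ≤ 1`).
* §2 **`card_alive_prod_le`** (`#{S : Φ_S(x) ≠ 0} ≤ Π_ν #{s : φ_s(x_ν) ≠ 0}`), `card_alive_prod_le_pow` (`≤ μ₁^{#A}` when each axis has `≤ μ₁` alive).
* §3 one-coordinate steps (`x′ = update x ν y′`): `prod_update_sub` (the factorisation), **`abs_prod_update_sub_le`** (`|Φ_S(x′) − Φ_S(x)| ≤ |φ_{S_ν}(y′) − φ_{S_ν}(x_ν)|`),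
  **`sum_sq_prod_update_sub_le`** (`Σ_S (Φ_S(x′) − Φ_S(x))² ≤ Σ_s (φ_s(y′) − φ_s(x_ν))²` — no `2^d`).
* §4 toy: `A = Fin 2` axes, `ι = X = Unit`, `φ ≡ 1`: `Σ_S Φ_S = 1` (`example`).

NOT HERE (honest): the chain∕torus instance (TPC supplies the axis; `ℤ∕KM ≃ ZMod K × Fin M`), the path bound `Λ` over a term, bonds vs sites; anything of Bałaban's.
BY-NAME EFFECT ON THE WALL: NONE.  NE7b NOT PRINTED ∕ NOT PROVED; spine PROVED 0∕9; rung (B)+1 on ONE finite T⁴ — NOT infinite volume, NOT the mass gap, NOT Clay.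
HONEST DEPENDENCY: continuum YM on T⁴ ⇐ BetaPertH ∧ nine spine estimates (0/9 proved); BetaPertH ⇐ (D1) ∧ (D4) ∧ CAP+tail; G-an2-4 gates asym, D1 and NE2/3/4.
-/

set_option autoImplicit false

noncomputable section

open Finset

namespace Summit.QuantumFields.BalabanUV.T4Continuum.NE7b.TentPartitionProduct

variable {A ι X : Type*} [Fintype A] [DecidableEq A] [Fintype ι]

/-! ## §1 The product is a partition of unity with values in `[0, 1]` -/

/-- **`Σ_S Π_ν φ_{S_ν}(x_ν) = 1`** when every axis family sums to one (`Finset.sum_prod_piFinset`). [folklore] -/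
theorem sum_prod_eq_one (φ : ι → X → ℝ) (hsum : ∀ y, ∑ s, φ s y = 1) (x : A → X) :
    ∑ S : A → ι, ∏ ν, φ (S ν) (x ν) = 1 := by
  have h := Finset.sum_prod_piFinset (Finset.univ : Finset ι) (fun ν s => φ s (x ν))
  rw [Fintype.piFinset_univ] at h
  rw [h]
  simp only [hsum, Finset.prod_const_one]

omit [Fintype A] [DecidableEq A] [Fintype ι] in
/-- `0 ≤ Π_ν φ_{S_ν}(x_ν)` for a nonnegative family. [folklore] -/
theorem prod_nonneg' (φ : ι → X → ℝ) (h0 : ∀ s y, 0 ≤ φ s y) (S : A → ι) (x : A → X) (T : Finset A) :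
    0 ≤ ∏ ν ∈ T, φ (S ν) (x ν) :=
  Finset.prod_nonneg fun _ _ => h0 _ _

omit [Fintype A] [DecidableEq A] [Fintype ι] in
/-- `Π_ν φ_{S_ν}(x_ν) ≤ 1` for a family with values in `[0, 1]`. [folklore] -/
theorem prod_le_one' (φ : ι → X → ℝ) (h0 : ∀ s y, 0 ≤ φ s y) (h1 : ∀ s y, φ s y ≤ 1) (S : A → ι) (x : A → X) (T : Finset A) :
    ∏ ν ∈ T, φ (S ν) (x ν) ≤ 1 :=
  Finset.prod_le_one (fun _ _ => h0 _ _) fun _ _ => h1 _ _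

/-! ## §2 Multiplicity: the alive cubes sit in the product of the axis-wise alive sets -/

/-- **`#{S : Φ_S(x) ≠ 0} ≤ Π_ν #{s : φ_s(x_ν) ≠ 0}`** (a product is nonzero only if every factor is). [folklore] -/
theorem card_alive_prod_le (φ : ι → X → ℝ) (x : A → X) :
    (Finset.univ.filter fun S : A → ι => ∏ ν, φ (S ν) (x ν) ≠ 0).card
      ≤ ∏ ν, (Finset.univ.filter fun s => φ s (x ν) ≠ 0).card := by
  rw [← Fintype.card_piFinset]
  refine Finset.card_le_card fun S hS => ?_
  rw [Finset.mem_filter] at hS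
  rw [Fintype.mem_piFinset]
  intro ν
  rw [Finset.mem_filter]
  exact ⟨Finset.mem_univ _, fun h0 => hS.2 (Finset.prod_eq_zero (Finset.mem_univ ν) h0)⟩

/-- … hence `≤ μ₁^{#A}` when every axis has at most `μ₁` cubes alive at every site (`μ₁ = 2` for the tent ⇒ `2^d`). [folklore] -/
theorem card_alive_prod_le_pow (φ : ι → X → ℝ) {μ₁ : ℕ} (hμ : ∀ y, (Finset.univ.filter fun s => φ s y ≠ 0).card ≤ μ₁) (x : A → X) :
    (Finset.univ.filter fun S : A → ι => ∏ ν, φ (S ν) (x ν) ≠ 0).card ≤ μ₁ ^ Fintype.card A :=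
  (card_alive_prod_le φ x).trans <| by
    rw [← Finset.card_univ, ← Finset.prod_const]
    exact Finset.prod_le_prod' fun ν _ => hμ (x ν)

/-! ## §3 One-coordinate steps: the product moves no more than the axis family -/

omit [Fintype ι] in
/-- THE FACTORISATION: `Φ_S(update x ν y′) − Φ_S(x) = (Π_{μ≠ν} φ_{S_μ}(x_μ))·(φ_{S_ν}(y′) − φ_{S_ν}(x_ν))`. [folklore] -/
theorem prod_update_sub (φ : ι → X → ℝ) (S : A → ι) (x : A → X) (ν : A) (y' : X) :
    ∏ μ, φ (S μ) (Function.update x ν y' μ) - ∏ μ, φ (S μ) (x μ)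
      = (∏ μ ∈ Finset.univ.erase ν, φ (S μ) (x μ)) * (φ (S ν) y' - φ (S ν) (x ν)) := by
  rw [← Finset.mul_prod_erase Finset.univ (fun μ => φ (S μ) (Function.update x ν y' μ)) (Finset.mem_univ ν),
    ← Finset.mul_prod_erase Finset.univ (fun μ => φ (S μ) (x μ)) (Finset.mem_univ ν)]
  have he : ∏ μ ∈ Finset.univ.erase ν, φ (S μ) (Function.update x ν y' μ) = ∏ μ ∈ Finset.univ.erase ν, φ (S μ) (x μ) :=
    Finset.prod_congr rfl fun μ hμ => by rw [Function.update_of_ne (Finset.ne_of_mem_erase hμ)]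
  rw [he, Function.update_self]
  ring

omit [Fintype ι] in
/-- **THE POINTWISE STEP LETTER PASSES TO THE PRODUCT**: `|Φ_S(update x ν y′) − Φ_S(x)| ≤ |φ_{S_ν}(y′) − φ_{S_ν}(x_ν)|` for a family with values in `[0, 1]`
(the prefactor `Π_{μ≠ν}φ` lies in `[0, 1]`). [folklore] -/
theorem abs_prod_update_sub_le (φ : ι → X → ℝ) (h0 : ∀ s y, 0 ≤ φ s y) (h1 : ∀ s y, φ s y ≤ 1)
    (S : A → ι) (x : A → X) (ν : A) (y' : X) :
    |∏ μ, φ (S μ) (Function.update x ν y' μ) - ∏ μ, φ (S μ) (x μ)| ≤ |φ (S ν) y' - φ (S ν) (x ν)| := by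
  rw [prod_update_sub, abs_mul, abs_of_nonneg (prod_nonneg' φ h0 S x _)]
  exact mul_le_of_le_one_left (abs_nonneg _) (prod_le_one' φ h0 h1 S x _)

/-- **THE `ℓ²` STEP LETTER PASSES TO THE PRODUCT WITH CONSTANT ONE**: `Σ_S (Φ_S(update x ν y′) − Φ_S(x))² ≤ Σ_s (φ_s(y′) − φ_s(x_ν))²` for a partition of
unity with values in `[0, 1]` — `(ΔΦ_S)² = P_S²(Δφ_{S_ν})² ≤ P_S(Δφ_{S_ν})²` with `P_S = Π_{μ≠ν}φ_{S_μ}(x_μ) ∈ [0,1]`, and `Σ_S P_S(Δφ_{S_ν})²` factorises over the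
product index into `Π_{μ≠ν}(Σ_sφ_s(x_μ))·Σ_s(Δφ_s)² = Σ_s(Δφ_s)²`. [folklore] -/
theorem sum_sq_prod_update_sub_le (φ : ι → X → ℝ) (h0 : ∀ s y, 0 ≤ φ s y) (h1 : ∀ s y, φ s y ≤ 1) (hsum : ∀ y, ∑ s, φ s y = 1)
    (x : A → X) (ν : A) (y' : X) :
    ∑ S : A → ι, (∏ μ, φ (S μ) (Function.update x ν y' μ) - ∏ μ, φ (S μ) (x μ)) ^ 2
      ≤ ∑ s, (φ s y' - φ s (x ν)) ^ 2 := by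
  -- the weight family `g_μ(s)`: the squared step on the axis `ν`, the partition itself elsewhere
  set g : A → ι → ℝ := fun μ s => if μ = ν then (φ s y' - φ s (x ν)) ^ 2 else φ s (x μ) with hg
  -- (1) termwise: `(ΔΦ_S)² ≤ Π_μ g_μ(S_μ)`
  have hterm : ∀ S : A → ι,
      (∏ μ, φ (S μ) (Function.update x ν y' μ) - ∏ μ, φ (S μ) (x μ)) ^ 2 ≤ ∏ μ, g μ (S μ) := by
    intro S
    rw [prod_update_sub, mul_pow]
    have hP0 : 0 ≤ ∏ μ ∈ Finset.univ.erase ν, φ (S μ) (x μ) := prod_nonneg' φ h0 S x _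
    have hP1 : ∏ μ ∈ Finset.univ.erase ν, φ (S μ) (x μ) ≤ 1 := prod_le_one' φ h0 h1 S x _
    have hsq : (∏ μ ∈ Finset.univ.erase ν, φ (S μ) (x μ)) ^ 2 ≤ ∏ μ ∈ Finset.univ.erase ν, φ (S μ) (x μ) := by
      nlinarith
    -- `Π_μ g_μ(S_μ) = (Δφ_{S_ν})² · Π_{μ≠ν} φ_{S_μ}(x_μ)`
    have hgprod : ∏ μ, g μ (S μ) = (φ (S ν) y' - φ (S ν) (x ν)) ^ 2 * ∏ μ ∈ Finset.univ.erase ν, φ (S μ) (x μ) := by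
      rw [← Finset.mul_prod_erase Finset.univ (fun μ => g μ (S μ)) (Finset.mem_univ ν)]
      congr 1
      · simp only [hg, if_true]
      · exact Finset.prod_congr rfl fun μ hμ => by simp only [hg, if_neg (Finset.ne_of_mem_erase hμ)]
    rw [hgprod, mul_comm]
    exact mul_le_mul_of_nonneg_left hsq (sq_nonneg _)
  -- (2) the sum over the product index factorises
  have hfac : ∑ S : A → ι, ∏ μ, g μ (S μ) = ∏ μ, ∑ s, g μ s := by
    have h := Finset.sum_prod_piFinset (Finset.univ : Finset ι) g
    rw [Fintype.piFinset_univ] at h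
    exact h
  -- (3) the factors: `Σ_s g_ν(s)` is the target, the others are `1`
  have hfactors : ∏ μ, ∑ s, g μ s = ∑ s, (φ s y' - φ s (x ν)) ^ 2 := by
    rw [← Finset.mul_prod_erase Finset.univ (fun μ => ∑ s, g μ s) (Finset.mem_univ ν)]
    have hν : ∑ s, g ν s = ∑ s, (φ s y' - φ s (x ν)) ^ 2 := by simp only [hg, if_true]
    have hrest : ∏ μ ∈ Finset.univ.erase ν, ∑ s, g μ s = 1 :=
      Finset.prod_eq_one fun μ hμ => by simp only [hg, if_neg (Finset.ne_of_mem_erase hμ), hsum]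
    rw [hν, hrest, mul_one]
  calc ∑ S : A → ι, (∏ μ, φ (S μ) (Function.update x ν y' μ) - ∏ μ, φ (S μ) (x μ)) ^ 2
      ≤ ∑ S : A → ι, ∏ μ, g μ (S μ) := Finset.sum_le_sum fun S _ => hterm S
    _ = ∑ s, (φ s y' - φ s (x ν)) ^ 2 := by rw [hfac, hfactors]

/-! ## §4 Toy: two axes, one cube, one site per axis -/

example : ∑ S : Fin 2 → Unit, ∏ ν, (fun (_ : Unit) (_ : Unit) => (1 : ℝ)) (S ν) ((fun _ => ()) ν) = 1 :=
  sum_prod_eq_one (A := Fin 2) (fun (_ : Unit) (_ : Unit) => (1 : ℝ)) (fun _ => by simp) fun _ => ()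

end Summit.QuantumFields.BalabanUV.T4Continuum.NE7b.TentPartitionProduct

end
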